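import Literature.NumberTheory.Rogawski1990.DepthZeroKappaTransferTypeOneGSideTrace    -- ★ p851882 (this seat's lineage, (P3f)(2)): the G-side in the trace frame MODULO the two count packages `hCOne hCPi`
import Literature.NumberTheory.Rogawski1990.DepthZeroKappaTransferTypeOneCountsTrace   -- (C6)-6 STAGE 1 (this seat): `rankStrata_counts_of_congr_traceTorusElt{Pi,}` = the texts of `hCPi ∕ hCOne`, modulo the export counts
import HarnessLib

/-!
# The depth-zero κ-transfer, type (1): the G-SIDE in the TRACE frame with the LAYER-B count packages DISCHARGED — modulo the two (C5)′ export counts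

Topic `NumberTheory/Rogawski1990`; namespace `Literature.NumberTheory.Rogawski1990`.  THEOREMS ONLY (no definition, no instance, no notation, no named fact,
no `sorry`); kernel lane `--supports stmt-HodgeConjecture-24833`; count-neutral.  Cell `pub/hodgecm-mathlib`, crux H413, (C6) LAYER-C re-type, brick (C6)-6 (dealer
LH4-plan (g7) WORDS #55∕#58∕#69∕#78 (i′)): the thin `…OfCount` wrapper of ★ p851882 `finsum_finExplicitDelta_mul_classOrbitalIntegral_depthZero_eq_of_split_trace`
(the fully closed top `…GSideTraceClosed` — no `hX` — is the separate sequel once the two (C5)′ export heads land).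

* `finsum_finExplicitDelta_mul_classOrbitalIntegral_depthZero_eq_of_split_trace_of_count` — ★ p851882's head with its two LAYER-B hypotheses `hCOne` (θ̄ = 0
  counts) and `hCPi` (θ̄ = 1 counts) DISCHARGED by ★ (C6)-6 `rankStrata_counts_of_congr_traceTorusElt` ∕ `…EltPi`, i.e. REPLACED by what those need beyond
  p851882's own binders: the integrality ∕ unit-discriminant data `(hbv : |b|_w ≤ 1) (hbδ : |σ b − b|_w = 1)` of the trace datum and the two (C5)′ inert EXPORT
  counts `hX₀` (θ̄ = 0, `#Fix = φ₀`) and `hX₁` (θ̄ = 1, `#Fix = φ₁`) at `(L, w)` — the texts of ★ (C6)-4∕(C6)-5's `_of_count` hypotheses verbatim.  Conclusion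
  byte-identical with ★ p851882: `Σᶠ_c Δ‴_v(γ_H, c)·Φ(c, g) = ν_G(K)·((q⁻² c₀ + ((q²−1)∕q²) c₁)·W(N−1) + (−q⁻¹ c₁ + ((q+1)∕q) c₂)·(W(N) − W(N−1)))`.  The fully
  closed `…_closed` (no `hX`) is one more application, in the sequel `…GSideTraceClosed`, once the two export heads land.

## References
* [Rogawski1990] J. D. Rogawski, *Automorphic Representations of Unitary Groups in Three Variables*, Ann. of Math. Stud. 123 (1990): §4.9 Prop. 4.9.1 (a)(b) p. 55,
  Lemma 4.9.3 p. 56; §4.3 (4.3.1)–(4.3.2) p. 43.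
* [Flicker1998UnitaryFL] Y. Z. Flicker, *Elementary proof of the fundamental lemma for a unitary group*, Canad. J. Math. 50 (1998): Prop. 3 p. 78, Props. 11–14
  pp. 87–94, §6 Thm. 15 p. 95.
* [Kottwitz1986] R. Kottwitz, *Base change for unit elements of Hecke algebras*, Compositio Math. 60 (1986): §3.
-/

set_option autoImplicit false

noncomputable section

open MeasureTheory Measure Set Function NumberField IsDedekindDomain Matrix Polynomial Topology Filter
open Literature.NumberTheory.Automorphic Literature.NumberTheory.Automorphic.UnitaryGroup
open Literature.NumberTheory.Automorphic.IntegralReduction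
open Literature.NumberTheory.GaloisRepresentations Literature.NumberTheory.NumberFields Literature.NumberTheory.QuadraticForms
open Literature.NumberTheory.Automorphic.HermitianLattice (unitaryInt)
open scoped Matrix MatrixGroups ValuativeRel

namespace Literature.NumberTheory.Rogawski1990

variable (L : Type) [Field L] [NumberField L] [IsCMField L] {v : HeightOneSpectrum (𝓞 ↥(maximalRealSubfield L))} (H' : Matrix (Fin 3) (Fin 3) L)

set_option synthInstance.maxHeartbeats 200000 in  -- the coset action `U_w ↷ U_w ⧸ unitaryInt` inside `hX₀ ∕ hX₁` (as in ★ (C6)-4∕(C6)-5)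
set_option maxHeartbeats 4000000 in  -- as ★ p851882: the 120-line head itself
open scoped Classical in
/-- **THE G-SIDE OF THE TYPE-(1) CLAUSE AT A DEPTH-ZERO PIECE, IN THE TRACE FRAME, MODULO ONLY THE TWO (C5)′ EXPORT COUNTS.**  ★ p851882
`finsum_finExplicitDelta_mul_classOrbitalIntegral_depthZero_eq_of_split_trace` VERBATIM except: the LAYER-B hypotheses `(hCOne) (hCPi)` are GONE — discharged by ★
`rankStrata_counts_of_congr_traceTorusElt` ∕ `rankStrata_counts_of_congr_traceTorusEltPi` ((C6)-6) — and in their place stand `(hbv) (hbδ)` (after `hπN`) and the two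
inert export counts `(hX₀) (hX₁)` at `(L, w)` (θ̄ = 0: `#Fix_t(U_w ⧸ U_w(𝒪)) = φ₀(N₁, N₂, N)` in Flicker's triangle; θ̄ = 1: `= φ₁(N₁, N)`), texts = ★ (C6)-4∕(C6)-5's
`_of_count` hypotheses.  Conclusion byte-identical.  PROOF = one application of ★ p851882.
[cite: Rogawski1990, §4.9 Prop. 4.9.1 (a)(b) p. 55; §4.3 (4.3.1)–(4.3.2) p. 43] [cite: Flicker1998UnitaryFL, Prop. 3 p. 78; Prop. 11 p. 87; §6 Thm. 15 p. 95]
[cite: Kottwitz1986, §3] -/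
theorem finsum_finExplicitDelta_mul_classOrbitalIntegral_depthZero_eq_of_split_trace_of_count
    (hH' : (H'.map (IsCMField.complexConj L))ᵀ = H') (w : PlacesOver L v)
    (hw : IsCMField.complexConj L • w.1 = w.1) (hv : Algebra.IsUnramifiedIn (𝓞 L) v.asIdeal)
    (hH'w : IsUnit (placeForm H' w.1)) (hH'i : hH'w.unit ∈ glInt 3 (w.1.adicCompletion L))
    (μ : HeckeCharacter L) (hμ : μ.IsUnramifiedAt w.1)
    [∀ γ : ((cmDatum L 3 H').Local v), MeasurableSpace (((cmDatum L 3 H').Local v) ⧸ Subgroup.centralizer ({γ} : Set ((cmDatum L 3 H').Local v)))]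
    (hl : ∀ (v : HeightOneSpectrum (𝓞 ↥(maximalRealSubfield L)))
      (a : (cmDatum L 2 (Matrix.of fun i j : Fin 2 => if i.val + j.val + 1 = 2 then (1 : L) else 0)).Local v ×
      (cmDatum L 1 (Matrix.of fun i j : Fin 1 => if i.val + j.val + 1 = 1 then (1 : L) else 0)).Local v)
      (b : (cmDatum L 3 H').Local v)
      (x : (cmDatum L 2 (Matrix.of fun i j : Fin 2 => if i.val + j.val + 1 = 2 then (1 : L) else 0)).Local v ×
      (cmDatum L 1 (Matrix.of fun i j : Fin 1 => if i.val + j.val + 1 = 1 then (1 : L) else 0)).Local v),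
      finExplicitDelta L v H' (x * a * x⁻¹) μ b = finExplicitDelta L v H' a μ b)
    (hr : ∀ (v : HeightOneSpectrum (𝓞 ↥(maximalRealSubfield L)))
      (a : (cmDatum L 2 (Matrix.of fun i j : Fin 2 => if i.val + j.val + 1 = 2 then (1 : L) else 0)).Local v ×
      (cmDatum L 1 (Matrix.of fun i j : Fin 1 => if i.val + j.val + 1 = 1 then (1 : L) else 0)).Local v)
      (b y : (cmDatum L 3 H').Local v),
      finExplicitDelta L v H' a μ (y * b * y⁻¹) = finExplicitDelta L v H' a μ b)
    (hH'u : IsUnit H')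
    (hμω : ∀ x : ideleGroup ↥(maximalRealSubfield L), μ (AdeleRing.ideleBaseChange ↥(maximalRealSubfield L) L x) = quadraticHeckeCharCM L x)
    {γH : ((cmDatum L 2 (Matrix.of fun i j : Fin 2 => if i.val + j.val + 1 = 2 then (1 : L) else 0)).Local v ×
      (cmDatum L 1 (Matrix.of fun i j : Fin 1 => if i.val + j.val + 1 = 1 then (1 : L) else 0)).Local v)}
    -- the split eigen-data of `stub_splitExponents`
    (α γ : w.1.adicCompletion L) (N₁ N₂ : ℕ)
    (hα : ((((γH.1.val : GL (Fin 2) (LocalRing L v)) : Matrix (Fin 2) (Fin 2) (LocalRing L v)).charpoly).map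
        (Pi.evalRingHom (fun w' : PlacesOver L v => w'.1.adicCompletion L) w)).IsRoot α)
    (hγ : ((((γH.1.val : GL (Fin 2) (LocalRing L v)) : Matrix (Fin 2) (Fin 2) (LocalRing L v)).charpoly).map
        (Pi.evalRingHom (fun w' : PlacesOver L v => w'.1.adicCompletion L) w)).IsRoot γ)
    (hαγ : α ≠ γ)
    (hN₁ : Valued.v (α - finGammaTwo L v γH w) = WithZero.exp (-(N₁ : ℤ)))
    (hN₂ : Valued.v (γ - finGammaTwo L v γH w) = WithZero.exp (-(N₂ : ℤ)))
    -- the 2-free scalars of the trace frame (★ `exists_traceFrame_scalars_of_nonsplit'`) and an eigenframe of `g` over `E_v` (★ (E1))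
    {b ε π π' a d : LocalRing L v} (hb : b + conjLocal L (IsCMField.complexConj L) v b = 1) (hσπ : conjLocal L (IsCMField.complexConj L) v π = π) (hππ : π * π' = 1)
    (hπN : ∀ z : LocalRing L v, conjLocal L (IsCMField.complexConj L) v z * z ≠ π)
    (hbv : Valued.v (b w) ≤ 1) (hbδ : Valued.v ((conjLocal L (IsCMField.complexConj L) v b - b) w) = 1)  -- (R-bv)∕T7: the trace datum is integral with unit discriminant at `w`
    (hε : conjLocal L (IsCMField.complexConj L) v ε * ε = -1)
    (ha1 : conjLocal L (IsCMField.complexConj L) v a * a = 1) (hd1 : conjLocal L (IsCMField.complexConj L) v d * d = 1)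
    {P₂ : GL (Fin 2) (LocalRing L v)} (hP₂ : (γH.1.val.val : Matrix (Fin 2) (Fin 2) (LocalRing L v)) * P₂.val = P₂.val * diagonal ![a, d])
    (had : a ≠ d) (hab : a ≠ finGammaTwo L v γH) (hbd : finGammaTwo L v γH ≠ d)
    (hu0 : a w = α) (hu1w : d w = γ) (N : ℕ) (hN : Valued.v (α - γ) = WithZero.exp (-(N : ℤ)))
    (htri : (N₁ = N₂ ∧ N₁ ≤ N) ∨ (N₁ = N ∧ N₁ ≤ N₂) ∨ (N₂ = N ∧ N₂ ≤ N₁))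
    (hα1 : Valued.v (α - 1) < 1) (hγ1 : Valued.v (γ - 1) < 1) (hb1 : Valued.v (finGammaTwo L v γH w - 1) < 1)
    [MeasurableSpace ((cmDatum L 3 H').Local v)] [BorelSpace ((cmDatum L 3 H').Local v)]
    [∀ γ : ((cmDatum L 3 H').Local v), BorelSpace (((cmDatum L 3 H').Local v) ⧸ Subgroup.centralizer ({γ} : Set ((cmDatum L 3 H').Local v)))]
    (νG : Measure ((cmDatum L 3 H').Local v)) [νG.IsHaarMeasure] [νG.IsMulRightInvariant]
    {mG : OrbitalMeasureFamily ((cmDatum L 3 H').Local v)}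
    (hmG : mG.IsCanonical (fun γ => IsRegularElt (γ.val : GL (Fin 3) (UnitaryGroup.LocalRing L v))) νG)
    (g : ((cmDatum L 3 H').Local v) → ℂ) (hg : IsLocSmooth g) (hgK : tsupport g ⊆ (cmLocalIntegralLevel L 3 H' v : Set ((cmDatum L 3 H').Local v)))
    (hginv : ∀ u ∈ cmLocalIntegralLevel L 3 H' v, ∀ x, g (u * x * u⁻¹) = g x)
    (c : ℕ → ℂ)
    (hc : ∀ k ∈ cmLocalIntegralLevel L 3 H' v,
      (redMat (((k.val : GL (Fin 3) (UnitaryGroup.LocalRing L v)).val.map (Pi.evalRingHom (fun w' : PlacesOver L v => w'.1.adicCompletion L) w))) - 1) ^ 3 = 0 →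
      g k = c (redMat (((k.val : GL (Fin 3) (UnitaryGroup.LocalRing L v)).val.map (Pi.evalRingHom (fun w' : PlacesOver L v => w'.1.adicCompletion L) w))) - 1).rank)
    -- LAYER B's two count heads, as hypotheses (θ̄ = 0 literal `t₁^{(b)}`, θ̄ = 1 literal `t_π^{(b)}`)
    -- the two (C5)′ inert EXPORT counts at `(L, w)`, carried as hypotheses until they land (texts = ★ (C6)-4∕(C6)-5 `_of_count` hypotheses, verbatim)
    (hX₀ : ∀ {b₀ : w.1.adicCompletion L}, b₀ + galAdicCompletionMap (L := L) (IsCMField.complexConj L) hw b₀ = 1 → Valued.v b₀ ≤ 1 →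
      Valued.v (galAdicCompletionMap (L := L) (IsCMField.complexConj L) hw b₀ - b₀) = 1 →
      ∀ {a₁ a₂ a₃ : w.1.adicCompletion L}, galAdicCompletionMap (L := L) (IsCMField.complexConj L) hw a₁ * a₁ = 1 →
      galAdicCompletionMap (L := L) (IsCMField.complexConj L) hw a₂ * a₂ = 1 → galAdicCompletionMap (L := L) (IsCMField.complexConj L) hw a₃ * a₃ = 1 →
      ∀ {t₀ : ↥(unitaryGroupOfForm (galAdicCompletionMap (L := L) (IsCMField.complexConj L) hw)
        (placeForm (Matrix.of fun i j : Fin 3 => if i.val + j.val + 1 = 3 then (1 : L) else 0) w.1))},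
      ((t₀ : GL (Fin 3) (w.1.adicCompletion L)) : Matrix (Fin 3) (Fin 3) (w.1.adicCompletion L)) =
        !![a₁ * galAdicCompletionMap (L := L) (IsCMField.complexConj L) hw b₀ + a₃ * b₀, 0, a₁ - a₃; 0, a₂, 0;
          b₀ * galAdicCompletionMap (L := L) (IsCMField.complexConj L) hw b₀ * (a₁ - a₃), 0,
          a₁ * b₀ + a₃ * galAdicCompletionMap (L := L) (IsCMField.complexConj L) hw b₀] →
      ∀ {N N₁ N₂ : ℕ}, Valued.v (a₁ - a₃) = WithZero.exp (-(N : ℤ)) → Valued.v (a₁ - a₂) = WithZero.exp (-(N₁ : ℤ)) →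
      Valued.v (a₃ - a₂) = WithZero.exp (-(N₂ : ℤ)) →
      ((N₁ = N₂ ∧ N₁ ≤ N) ∨ (N₁ = N ∧ N₁ ≤ N₂) ∨ (N₂ = N ∧ N₂ ≤ N₁)) →
      {x : ↥(unitaryGroupOfForm (galAdicCompletionMap (L := L) (IsCMField.complexConj L) hw)
          (placeForm (Matrix.of fun i j : Fin 3 => if i.val + j.val + 1 = 3 then (1 : L) else 0) w.1)) ⧸
        unitaryInt (galAdicCompletionMap (L := L) (IsCMField.complexConj L) hw)
          (placeForm (Matrix.of fun i j : Fin 3 => if i.val + j.val + 1 = 3 then (1 : L) else 0) w.1) | t₀ • x = x}.Finite →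
      (Nat.card {x : ↥(unitaryGroupOfForm (galAdicCompletionMap (L := L) (IsCMField.complexConj L) hw)
          (placeForm (Matrix.of fun i j : Fin 3 => if i.val + j.val + 1 = 3 then (1 : L) else 0) w.1)) ⧸
        unitaryInt (galAdicCompletionMap (L := L) (IsCMField.complexConj L) hw)
          (placeForm (Matrix.of fun i j : Fin 3 => if i.val + j.val + 1 = 3 then (1 : L) else 0) w.1) | t₀ • x = x} : ℚ) =
        Flicker1998.phiZero (Ideal.absNorm v.asIdeal) N₁ N₂ N)
    (hX₁ : ∀ {b₀ : w.1.adicCompletion L}, b₀ + galAdicCompletionMap (L := L) (IsCMField.complexConj L) hw b₀ = 1 → Valued.v b₀ ≤ 1 →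
      Valued.v (galAdicCompletionMap (L := L) (IsCMField.complexConj L) hw b₀ - b₀) = 1 →
      ∀ {a₁ a₂ a₃ ϖ₁ ϖ₁' : w.1.adicCompletion L}, galAdicCompletionMap (L := L) (IsCMField.complexConj L) hw a₁ * a₁ = 1 →
      galAdicCompletionMap (L := L) (IsCMField.complexConj L) hw a₂ * a₂ = 1 → galAdicCompletionMap (L := L) (IsCMField.complexConj L) hw a₃ * a₃ = 1 →
      galAdicCompletionMap (L := L) (IsCMField.complexConj L) hw ϖ₁ = ϖ₁ → ϖ₁ * ϖ₁' = 1 →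
      (∀ z : w.1.adicCompletion L, galAdicCompletionMap (L := L) (IsCMField.complexConj L) hw z * z ≠ ϖ₁) →
      ∀ {t₀ : ↥(unitaryGroupOfForm (galAdicCompletionMap (L := L) (IsCMField.complexConj L) hw)
        (placeForm (Matrix.of fun i j : Fin 3 => if i.val + j.val + 1 = 3 then (1 : L) else 0) w.1))},
      ((t₀ : GL (Fin 3) (w.1.adicCompletion L)) : Matrix (Fin 3) (Fin 3) (w.1.adicCompletion L)) =
        !![a₁ * galAdicCompletionMap (L := L) (IsCMField.complexConj L) hw b₀ + a₃ * b₀, 0, ϖ₁ * (a₁ - a₃); 0, a₂, 0;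
          ϖ₁' * (b₀ * galAdicCompletionMap (L := L) (IsCMField.complexConj L) hw b₀ * (a₁ - a₃)), 0,
          a₁ * b₀ + a₃ * galAdicCompletionMap (L := L) (IsCMField.complexConj L) hw b₀] →
      ∀ {N N₁ N₂ : ℕ}, Valued.v (a₁ - a₃) = WithZero.exp (-(N : ℤ)) → Valued.v (a₁ - a₂) = WithZero.exp (-(N₁ : ℤ)) →
      Valued.v (a₃ - a₂) = WithZero.exp (-(N₂ : ℤ)) →
      {x : ↥(unitaryGroupOfForm (galAdicCompletionMap (L := L) (IsCMField.complexConj L) hw)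
          (placeForm (Matrix.of fun i j : Fin 3 => if i.val + j.val + 1 = 3 then (1 : L) else 0) w.1)) ⧸
        unitaryInt (galAdicCompletionMap (L := L) (IsCMField.complexConj L) hw)
          (placeForm (Matrix.of fun i j : Fin 3 => if i.val + j.val + 1 = 3 then (1 : L) else 0) w.1) | t₀ • x = x}.Finite →
      (Nat.card {x : ↥(unitaryGroupOfForm (galAdicCompletionMap (L := L) (IsCMField.complexConj L) hw)
          (placeForm (Matrix.of fun i j : Fin 3 => if i.val + j.val + 1 = 3 then (1 : L) else 0) w.1)) ⧸
        unitaryInt (galAdicCompletionMap (L := L) (IsCMField.complexConj L) hw)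
          (placeForm (Matrix.of fun i j : Fin 3 => if i.val + j.val + 1 = 3 then (1 : L) else 0) w.1) | t₀ • x = x} : ℚ) =
        Flicker1998.phiOne (Ideal.absNorm v.asIdeal) N₁ N) :
    ∑ᶠ cG : ConjClasses ((cmDatum L 3 H').Local v),
        (finExplicitCollection L H' μ hl hr v).Δ γH (Quotient.out cG) * classOrbitalIntegral mG g cG =
      (νG.real (cmLocalIntegralLevel L 3 H' v : Set ((cmDatum L 3 H').Local v)) : ℂ) *
        (((((Ideal.absNorm v.asIdeal : ℂ)) ^ 2)⁻¹ * c 0 + ((((Ideal.absNorm v.asIdeal : ℂ)) ^ 2 - 1) / ((Ideal.absNorm v.asIdeal : ℂ)) ^ 2) * c 1) *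
          ((Flicker1998.phiH (Ideal.absNorm v.asIdeal) (N - 1) : ℚ) : ℂ) +
        (-((Ideal.absNorm v.asIdeal : ℂ))⁻¹ * c 1 + ((((Ideal.absNorm v.asIdeal : ℂ)) + 1) / ((Ideal.absNorm v.asIdeal : ℂ))) * c 2) *
          ((Flicker1998.phiH (Ideal.absNorm v.asIdeal) N - Flicker1998.phiH (Ideal.absNorm v.asIdeal) (N - 1) : ℚ) : ℂ)) :=
  finsum_finExplicitDelta_mul_classOrbitalIntegral_depthZero_eq_of_split_trace L H' hH' w hw hv hH'w hH'i μ hμ hl hr hH'u hμω α γ N₁ N₂ hα hγ hαγ hN₁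
    hN₂ hb hσπ hππ hπN hε ha1 hd1 hP₂ had hab hbd hu0 hu1w N hN htri hα1 hγ1 hb1 νG hmG g hg hgK hginv c hc
    (rankStrata_counts_of_congr_traceTorusElt L H' hH' hH'u w hw hv hH'w hH'i hb hbv hbδ hX₀)
    (rankStrata_counts_of_congr_traceTorusEltPi L H' hH' hH'u w hw hv hH'w hH'i hb hbv hbδ hσπ hππ hπN hX₁)

end Literature.NumberTheory.Rogawski1990

end
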